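import Mathlib
import Summits.Ventures.PercRepro2.Defs
import Summits.Ventures.PercRepro2.Independence
import Summits.Ventures.PercRepro2.ZCTwoEdge

/-!
# Theorem I (MINE-A.md §74.5) — the four cells of the two edges at `o`, mirror placement
`o` between `a₃` and a non-mark `w` (blind cell PercRepro2, mine-a g25)

Bookkeeping for `ZCOA3W.lean`: with `f₁ = oa₃`, `f₂ = ow` and the events of `G − o` `A = {a₁ ↔ a₃}`,
`W = {a₁ ↔ w}`, `Γ = {a₃ ↔ w}`, `X₀ = {C(a₁) ∈ 𝒰}`, `X₁ = {C(a₁) ∪ {o} ∈ 𝒰}`, `X₂ = {C(a₁) ∪ C(w) ∪ {o} ∈ 𝒰}`,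
`X₃ = {C(a₁) ∪ C(a₃) ∪ {o} ∈ 𝒰}` (all ignoring `f₁`, `f₂`), the (ZC) events of `G` are
`e = A ∪ ({f₁, f₂ open} ∩ W)`, `L = ({f₁ open} ∩ A) ∪ ({f₂ open} ∩ W)`, `γ = {f₁ open} ∪ ({f₂ open} ∩ Γ)`,
`U = ({f₁, f₂} ∩ A ∩ Wᶜ ∩ X₂) ∪ ({f₁, f₂} ∩ Aᶜ ∩ W ∩ X₃) ∪ (L ∩ ({f₁, f₂} ∩ ((A ∩ Wᶜ) ∪ (Aᶜ ∩ W)))ᶜ ∩ X₁) ∪ (Lᶜ ∩ X₀)`,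
and the seven probabilities of (ZC) expand over the four states of `(f₁, f₂)` (`prob_two_pin`) into
probabilities of events of `G − o`: `oa3w_prob_eL`, `oa3w_prob_enL`, `oa3w_prob_UeL`, `oa3w_prob_UenL`,
`oa3w_prob_U`, `oa3w_prob_B`, `oa3w_prob_D`.  One seat.
-/

namespace Summit.Ventures.PercRepro2

section CellsI

variable {E : Type*} [Fintype E] [DecidableEq E] {R : Type*} [CommRing R]
  (p : E → R) {f₁ f₂ : E} (hf : f₁ ≠ f₂) {A W Γ X₀ X₁ X₂ X₃ : Set (Config E)}
  (hA : ∀ (ω : Config E) (b₁ b₂ : Bool), Function.update (Function.update ω f₁ b₁) f₂ b₂ ∈ A ↔ ω ∈ A)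
  (hW : ∀ (ω : Config E) (b₁ b₂ : Bool), Function.update (Function.update ω f₁ b₁) f₂ b₂ ∈ W ↔ ω ∈ W)
  (hΓ : ∀ (ω : Config E) (b₁ b₂ : Bool), Function.update (Function.update ω f₁ b₁) f₂ b₂ ∈ Γ ↔ ω ∈ Γ)
  (hX₀ : ∀ (ω : Config E) (b₁ b₂ : Bool), Function.update (Function.update ω f₁ b₁) f₂ b₂ ∈ X₀ ↔ ω ∈ X₀)
  (hX₁ : ∀ (ω : Config E) (b₁ b₂ : Bool), Function.update (Function.update ω f₁ b₁) f₂ b₂ ∈ X₁ ↔ ω ∈ X₁)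
  (hX₂ : ∀ (ω : Config E) (b₁ b₂ : Bool), Function.update (Function.update ω f₁ b₁) f₂ b₂ ∈ X₂ ↔ ω ∈ X₂)
  (hX₃ : ∀ (ω : Config E) (b₁ b₂ : Bool), Function.update (Function.update ω f₁ b₁) f₂ b₂ ∈ X₃ ↔ ω ∈ X₃)

include hf hA hW in
/-- The cell expansion of `P(e ∩ L)`. -/
lemma oa3w_prob_eL :
    prob p ((A ∪ (openEdge f₁ ∩ openEdge f₂ ∩ W)) ∩ ((openEdge f₁ ∩ A) ∪ (openEdge f₂ ∩ W)))
      = p f₁ * p f₂ * prob p (A ∪ W) + p f₁ * (1 - p f₂) * prob p A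
        + (1 - p f₁) * p f₂ * prob p (A ∩ W) := by
  have hs1 := update2_fst hf
  rw [prob_two_pin p hf]
  have e11 : {ω | Function.update (Function.update ω f₁ true) f₂ true ∈
      (A ∪ (openEdge f₁ ∩ openEdge f₂ ∩ W)) ∩ ((openEdge f₁ ∩ A) ∪ (openEdge f₂ ∩ W))} = A ∪ W := by
    ext ω; simp [hs1, hA, hW]
  have e10 : {ω | Function.update (Function.update ω f₁ true) f₂ false ∈
      (A ∪ (openEdge f₁ ∩ openEdge f₂ ∩ W)) ∩ ((openEdge f₁ ∩ A) ∪ (openEdge f₂ ∩ W))} = A := by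
    ext ω; simp [hs1, hA, hW]
  have e01 : {ω | Function.update (Function.update ω f₁ false) f₂ true ∈
      (A ∪ (openEdge f₁ ∩ openEdge f₂ ∩ W)) ∩ ((openEdge f₁ ∩ A) ∪ (openEdge f₂ ∩ W))} = A ∩ W := by
    ext ω; simp [hs1, hA, hW]
  have e00 : {ω | Function.update (Function.update ω f₁ false) f₂ false ∈
      (A ∪ (openEdge f₁ ∩ openEdge f₂ ∩ W)) ∩ ((openEdge f₁ ∩ A) ∪ (openEdge f₂ ∩ W))} = ∅ := by
    ext ω; simp [hs1, hA, hW]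
  rw [e11, e10, e01, e00, prob_empty]; ring

include hf hA hW in
/-- The cell expansion of `P(e ∩ Lᶜ)`. -/
lemma oa3w_prob_enL :
    prob p ((A ∪ (openEdge f₁ ∩ openEdge f₂ ∩ W)) ∩ ((openEdge f₁ ∩ A) ∪ (openEdge f₂ ∩ W))ᶜ)
      = (1 - p f₁) * p f₂ * prob p (A ∩ Wᶜ) + (1 - p f₁) * (1 - p f₂) * prob p A := by
  have hs1 := update2_fst hf
  rw [prob_two_pin p hf]
  have e11 : {ω | Function.update (Function.update ω f₁ true) f₂ true ∈
      (A ∪ (openEdge f₁ ∩ openEdge f₂ ∩ W)) ∩ ((openEdge f₁ ∩ A) ∪ (openEdge f₂ ∩ W))ᶜ} = ∅ := by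
    ext ω; simp [hs1, hA, hW]
  have e10 : {ω | Function.update (Function.update ω f₁ true) f₂ false ∈
      (A ∪ (openEdge f₁ ∩ openEdge f₂ ∩ W)) ∩ ((openEdge f₁ ∩ A) ∪ (openEdge f₂ ∩ W))ᶜ} = ∅ := by
    ext ω; simp [hs1, hA, hW]
  have e01 : {ω | Function.update (Function.update ω f₁ false) f₂ true ∈
      (A ∪ (openEdge f₁ ∩ openEdge f₂ ∩ W)) ∩ ((openEdge f₁ ∩ A) ∪ (openEdge f₂ ∩ W))ᶜ} = A ∩ Wᶜ := by
    ext ω; simp [hs1, hA, hW]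
  have e00 : {ω | Function.update (Function.update ω f₁ false) f₂ false ∈
      (A ∪ (openEdge f₁ ∩ openEdge f₂ ∩ W)) ∩ ((openEdge f₁ ∩ A) ∪ (openEdge f₂ ∩ W))ᶜ} = A := by
    ext ω; simp [hs1, hA, hW]
  rw [e11, e10, e01, e00, prob_empty]; ring

include hf hA hW hX₁ hX₂ hX₃ in
/-- The cell expansion of `P(U ∩ e ∩ L)`. -/
lemma oa3w_prob_UeL :
    prob p (((openEdge f₁ ∩ openEdge f₂ ∩ A ∩ Wᶜ ∩ X₂) ∪ (openEdge f₁ ∩ openEdge f₂ ∩ Aᶜ ∩ W ∩ X₃)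
        ∪ (((openEdge f₁ ∩ A) ∪ (openEdge f₂ ∩ W))
            ∩ (openEdge f₁ ∩ openEdge f₂ ∩ ((A ∩ Wᶜ) ∪ (Aᶜ ∩ W)))ᶜ ∩ X₁)
        ∪ (((openEdge f₁ ∩ A) ∪ (openEdge f₂ ∩ W))ᶜ ∩ X₀))
      ∩ ((A ∪ (openEdge f₁ ∩ openEdge f₂ ∩ W)) ∩ ((openEdge f₁ ∩ A) ∪ (openEdge f₂ ∩ W))))
      = p f₁ * p f₂ * prob p ((A ∩ W ∩ X₁) ∪ (A ∩ Wᶜ ∩ X₂) ∪ (Aᶜ ∩ W ∩ X₃))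
        + p f₁ * (1 - p f₂) * prob p (X₁ ∩ A) + (1 - p f₁) * p f₂ * prob p (X₁ ∩ (A ∩ W)) := by
  have hs1 := update2_fst hf
  rw [prob_two_pin p hf]
  have e11 : {ω | Function.update (Function.update ω f₁ true) f₂ true ∈
      ((openEdge f₁ ∩ openEdge f₂ ∩ A ∩ Wᶜ ∩ X₂) ∪ (openEdge f₁ ∩ openEdge f₂ ∩ Aᶜ ∩ W ∩ X₃)
        ∪ (((openEdge f₁ ∩ A) ∪ (openEdge f₂ ∩ W))
            ∩ (openEdge f₁ ∩ openEdge f₂ ∩ ((A ∩ Wᶜ) ∪ (Aᶜ ∩ W)))ᶜ ∩ X₁)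
        ∪ (((openEdge f₁ ∩ A) ∪ (openEdge f₂ ∩ W))ᶜ ∩ X₀))
      ∩ ((A ∪ (openEdge f₁ ∩ openEdge f₂ ∩ W)) ∩ ((openEdge f₁ ∩ A) ∪ (openEdge f₂ ∩ W)))}
      = (A ∩ W ∩ X₁) ∪ (A ∩ Wᶜ ∩ X₂) ∪ (Aᶜ ∩ W ∩ X₃) := by
    ext ω; simp [hs1, hA, hW, hX₁, hX₂, hX₃]; tauto
  have e10 : {ω | Function.update (Function.update ω f₁ true) f₂ false ∈
      ((openEdge f₁ ∩ openEdge f₂ ∩ A ∩ Wᶜ ∩ X₂) ∪ (openEdge f₁ ∩ openEdge f₂ ∩ Aᶜ ∩ W ∩ X₃)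
        ∪ (((openEdge f₁ ∩ A) ∪ (openEdge f₂ ∩ W))
            ∩ (openEdge f₁ ∩ openEdge f₂ ∩ ((A ∩ Wᶜ) ∪ (Aᶜ ∩ W)))ᶜ ∩ X₁)
        ∪ (((openEdge f₁ ∩ A) ∪ (openEdge f₂ ∩ W))ᶜ ∩ X₀))
      ∩ ((A ∪ (openEdge f₁ ∩ openEdge f₂ ∩ W)) ∩ ((openEdge f₁ ∩ A) ∪ (openEdge f₂ ∩ W)))}
      = X₁ ∩ A := by
    ext ω; simp [hs1, hA, hW, hX₁]; tauto
  have e01 : {ω | Function.update (Function.update ω f₁ false) f₂ true ∈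
      ((openEdge f₁ ∩ openEdge f₂ ∩ A ∩ Wᶜ ∩ X₂) ∪ (openEdge f₁ ∩ openEdge f₂ ∩ Aᶜ ∩ W ∩ X₃)
        ∪ (((openEdge f₁ ∩ A) ∪ (openEdge f₂ ∩ W))
            ∩ (openEdge f₁ ∩ openEdge f₂ ∩ ((A ∩ Wᶜ) ∪ (Aᶜ ∩ W)))ᶜ ∩ X₁)
        ∪ (((openEdge f₁ ∩ A) ∪ (openEdge f₂ ∩ W))ᶜ ∩ X₀))
      ∩ ((A ∪ (openEdge f₁ ∩ openEdge f₂ ∩ W)) ∩ ((openEdge f₁ ∩ A) ∪ (openEdge f₂ ∩ W)))}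
      = X₁ ∩ (A ∩ W) := by
    ext ω; simp [hs1, hA, hW, hX₁]; tauto
  have e00 : {ω | Function.update (Function.update ω f₁ false) f₂ false ∈
      ((openEdge f₁ ∩ openEdge f₂ ∩ A ∩ Wᶜ ∩ X₂) ∪ (openEdge f₁ ∩ openEdge f₂ ∩ Aᶜ ∩ W ∩ X₃)
        ∪ (((openEdge f₁ ∩ A) ∪ (openEdge f₂ ∩ W))
            ∩ (openEdge f₁ ∩ openEdge f₂ ∩ ((A ∩ Wᶜ) ∪ (Aᶜ ∩ W)))ᶜ ∩ X₁)
        ∪ (((openEdge f₁ ∩ A) ∪ (openEdge f₂ ∩ W))ᶜ ∩ X₀))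
      ∩ ((A ∪ (openEdge f₁ ∩ openEdge f₂ ∩ W)) ∩ ((openEdge f₁ ∩ A) ∪ (openEdge f₂ ∩ W)))} = ∅ := by
    ext ω; simp [hs1, hA, hW]
  rw [e11, e10, e01, e00, prob_empty]; ring

include hf hA hW hX₀ in
/-- The cell expansion of `P(U ∩ e ∩ Lᶜ)`. -/
lemma oa3w_prob_UenL :
    prob p (((openEdge f₁ ∩ openEdge f₂ ∩ A ∩ Wᶜ ∩ X₂) ∪ (openEdge f₁ ∩ openEdge f₂ ∩ Aᶜ ∩ W ∩ X₃)
        ∪ (((openEdge f₁ ∩ A) ∪ (openEdge f₂ ∩ W))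
            ∩ (openEdge f₁ ∩ openEdge f₂ ∩ ((A ∩ Wᶜ) ∪ (Aᶜ ∩ W)))ᶜ ∩ X₁)
        ∪ (((openEdge f₁ ∩ A) ∪ (openEdge f₂ ∩ W))ᶜ ∩ X₀))
      ∩ ((A ∪ (openEdge f₁ ∩ openEdge f₂ ∩ W)) ∩ ((openEdge f₁ ∩ A) ∪ (openEdge f₂ ∩ W))ᶜ))
      = (1 - p f₁) * p f₂ * prob p (X₀ ∩ (A ∩ Wᶜ)) + (1 - p f₁) * (1 - p f₂) * prob p (X₀ ∩ A) := by
  have hs1 := update2_fst hf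
  rw [prob_two_pin p hf]
  have e11 : {ω | Function.update (Function.update ω f₁ true) f₂ true ∈
      ((openEdge f₁ ∩ openEdge f₂ ∩ A ∩ Wᶜ ∩ X₂) ∪ (openEdge f₁ ∩ openEdge f₂ ∩ Aᶜ ∩ W ∩ X₃)
        ∪ (((openEdge f₁ ∩ A) ∪ (openEdge f₂ ∩ W))
            ∩ (openEdge f₁ ∩ openEdge f₂ ∩ ((A ∩ Wᶜ) ∪ (Aᶜ ∩ W)))ᶜ ∩ X₁)
        ∪ (((openEdge f₁ ∩ A) ∪ (openEdge f₂ ∩ W))ᶜ ∩ X₀))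
      ∩ ((A ∪ (openEdge f₁ ∩ openEdge f₂ ∩ W)) ∩ ((openEdge f₁ ∩ A) ∪ (openEdge f₂ ∩ W))ᶜ)} = ∅ := by
    ext ω; simp [hs1, hA, hW]; tauto
  have e10 : {ω | Function.update (Function.update ω f₁ true) f₂ false ∈
      ((openEdge f₁ ∩ openEdge f₂ ∩ A ∩ Wᶜ ∩ X₂) ∪ (openEdge f₁ ∩ openEdge f₂ ∩ Aᶜ ∩ W ∩ X₃)
        ∪ (((openEdge f₁ ∩ A) ∪ (openEdge f₂ ∩ W))
            ∩ (openEdge f₁ ∩ openEdge f₂ ∩ ((A ∩ Wᶜ) ∪ (Aᶜ ∩ W)))ᶜ ∩ X₁)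
        ∪ (((openEdge f₁ ∩ A) ∪ (openEdge f₂ ∩ W))ᶜ ∩ X₀))
      ∩ ((A ∪ (openEdge f₁ ∩ openEdge f₂ ∩ W)) ∩ ((openEdge f₁ ∩ A) ∪ (openEdge f₂ ∩ W))ᶜ)} = ∅ := by
    ext ω; simp [hs1, hA, hW]
  have e01 : {ω | Function.update (Function.update ω f₁ false) f₂ true ∈
      ((openEdge f₁ ∩ openEdge f₂ ∩ A ∩ Wᶜ ∩ X₂) ∪ (openEdge f₁ ∩ openEdge f₂ ∩ Aᶜ ∩ W ∩ X₃)
        ∪ (((openEdge f₁ ∩ A) ∪ (openEdge f₂ ∩ W))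
            ∩ (openEdge f₁ ∩ openEdge f₂ ∩ ((A ∩ Wᶜ) ∪ (Aᶜ ∩ W)))ᶜ ∩ X₁)
        ∪ (((openEdge f₁ ∩ A) ∪ (openEdge f₂ ∩ W))ᶜ ∩ X₀))
      ∩ ((A ∪ (openEdge f₁ ∩ openEdge f₂ ∩ W)) ∩ ((openEdge f₁ ∩ A) ∪ (openEdge f₂ ∩ W))ᶜ)}
      = X₀ ∩ (A ∩ Wᶜ) := by
    ext ω; simp [hs1, hA, hW, hX₀]; tauto
  have e00 : {ω | Function.update (Function.update ω f₁ false) f₂ false ∈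
      ((openEdge f₁ ∩ openEdge f₂ ∩ A ∩ Wᶜ ∩ X₂) ∪ (openEdge f₁ ∩ openEdge f₂ ∩ Aᶜ ∩ W ∩ X₃)
        ∪ (((openEdge f₁ ∩ A) ∪ (openEdge f₂ ∩ W))
            ∩ (openEdge f₁ ∩ openEdge f₂ ∩ ((A ∩ Wᶜ) ∪ (Aᶜ ∩ W)))ᶜ ∩ X₁)
        ∪ (((openEdge f₁ ∩ A) ∪ (openEdge f₂ ∩ W))ᶜ ∩ X₀))
      ∩ ((A ∪ (openEdge f₁ ∩ openEdge f₂ ∩ W)) ∩ ((openEdge f₁ ∩ A) ∪ (openEdge f₂ ∩ W))ᶜ)}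
      = X₀ ∩ A := by
    ext ω; simp [hs1, hA, hW, hX₀]
  rw [e11, e10, e01, e00, prob_empty]; ring

include hf hA hW hX₀ hX₁ hX₂ hX₃ in
/-- The cell expansion of `P(U)`. -/
lemma oa3w_prob_U :
    prob p ((openEdge f₁ ∩ openEdge f₂ ∩ A ∩ Wᶜ ∩ X₂) ∪ (openEdge f₁ ∩ openEdge f₂ ∩ Aᶜ ∩ W ∩ X₃)
        ∪ (((openEdge f₁ ∩ A) ∪ (openEdge f₂ ∩ W))
            ∩ (openEdge f₁ ∩ openEdge f₂ ∩ ((A ∩ Wᶜ) ∪ (Aᶜ ∩ W)))ᶜ ∩ X₁)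
        ∪ (((openEdge f₁ ∩ A) ∪ (openEdge f₂ ∩ W))ᶜ ∩ X₀))
      = p f₁ * p f₂ * prob p ((A ∩ W ∩ X₁) ∪ (A ∩ Wᶜ ∩ X₂) ∪ (Aᶜ ∩ W ∩ X₃) ∪ (Aᶜ ∩ Wᶜ ∩ X₀))
        + p f₁ * (1 - p f₂) * prob p ((A ∩ X₁) ∪ (Aᶜ ∩ X₀))
        + (1 - p f₁) * p f₂ * prob p ((W ∩ X₁) ∪ (Wᶜ ∩ X₀)) + (1 - p f₁) * (1 - p f₂) * prob p X₀ := by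
  have hs1 := update2_fst hf
  rw [prob_two_pin p hf]
  have e11 : {ω | Function.update (Function.update ω f₁ true) f₂ true ∈
      ((openEdge f₁ ∩ openEdge f₂ ∩ A ∩ Wᶜ ∩ X₂) ∪ (openEdge f₁ ∩ openEdge f₂ ∩ Aᶜ ∩ W ∩ X₃)
        ∪ (((openEdge f₁ ∩ A) ∪ (openEdge f₂ ∩ W))
            ∩ (openEdge f₁ ∩ openEdge f₂ ∩ ((A ∩ Wᶜ) ∪ (Aᶜ ∩ W)))ᶜ ∩ X₁)
        ∪ (((openEdge f₁ ∩ A) ∪ (openEdge f₂ ∩ W))ᶜ ∩ X₀))}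
      = (A ∩ W ∩ X₁) ∪ (A ∩ Wᶜ ∩ X₂) ∪ (Aᶜ ∩ W ∩ X₃) ∪ (Aᶜ ∩ Wᶜ ∩ X₀) := by
    ext ω; simp [hs1, hA, hW, hX₀, hX₁, hX₂, hX₃]; tauto
  have e10 : {ω | Function.update (Function.update ω f₁ true) f₂ false ∈
      ((openEdge f₁ ∩ openEdge f₂ ∩ A ∩ Wᶜ ∩ X₂) ∪ (openEdge f₁ ∩ openEdge f₂ ∩ Aᶜ ∩ W ∩ X₃)
        ∪ (((openEdge f₁ ∩ A) ∪ (openEdge f₂ ∩ W))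
            ∩ (openEdge f₁ ∩ openEdge f₂ ∩ ((A ∩ Wᶜ) ∪ (Aᶜ ∩ W)))ᶜ ∩ X₁)
        ∪ (((openEdge f₁ ∩ A) ∪ (openEdge f₂ ∩ W))ᶜ ∩ X₀))}
      = (A ∩ X₁) ∪ (Aᶜ ∩ X₀) := by
    ext ω; simp [hs1, hA, hW, hX₀, hX₁]
  have e01 : {ω | Function.update (Function.update ω f₁ false) f₂ true ∈
      ((openEdge f₁ ∩ openEdge f₂ ∩ A ∩ Wᶜ ∩ X₂) ∪ (openEdge f₁ ∩ openEdge f₂ ∩ Aᶜ ∩ W ∩ X₃)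
        ∪ (((openEdge f₁ ∩ A) ∪ (openEdge f₂ ∩ W))
            ∩ (openEdge f₁ ∩ openEdge f₂ ∩ ((A ∩ Wᶜ) ∪ (Aᶜ ∩ W)))ᶜ ∩ X₁)
        ∪ (((openEdge f₁ ∩ A) ∪ (openEdge f₂ ∩ W))ᶜ ∩ X₀))}
      = (W ∩ X₁) ∪ (Wᶜ ∩ X₀) := by
    ext ω; simp [hs1, hA, hW, hX₀, hX₁]
  have e00 : {ω | Function.update (Function.update ω f₁ false) f₂ false ∈
      ((openEdge f₁ ∩ openEdge f₂ ∩ A ∩ Wᶜ ∩ X₂) ∪ (openEdge f₁ ∩ openEdge f₂ ∩ Aᶜ ∩ W ∩ X₃)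
        ∪ (((openEdge f₁ ∩ A) ∪ (openEdge f₂ ∩ W))
            ∩ (openEdge f₁ ∩ openEdge f₂ ∩ ((A ∩ Wᶜ) ∪ (Aᶜ ∩ W)))ᶜ ∩ X₁)
        ∪ (((openEdge f₁ ∩ A) ∪ (openEdge f₂ ∩ W))ᶜ ∩ X₀))} = X₀ := by
    ext ω; simp [hs1, hA, hW, hX₀]
  rw [e11, e10, e01, e00]

include hf hA hW hΓ in
/-- The cell expansion of `P(B) = P(eᶜ ∩ Lᶜ ∩ γ)`. -/
lemma oa3w_prob_B :
    prob p ((A ∪ (openEdge f₁ ∩ openEdge f₂ ∩ W))ᶜ ∩ ((openEdge f₁ ∩ A) ∪ (openEdge f₂ ∩ W))ᶜ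
        ∩ (openEdge f₁ ∪ (openEdge f₂ ∩ Γ)))
      = p f₁ * p f₂ * prob p (Aᶜ ∩ Wᶜ) + p f₁ * (1 - p f₂) * prob p Aᶜ
        + (1 - p f₁) * p f₂ * prob p (Aᶜ ∩ Wᶜ ∩ Γ) := by
  have hs1 := update2_fst hf
  rw [prob_two_pin p hf]
  have e11 : {ω | Function.update (Function.update ω f₁ true) f₂ true ∈
      ((A ∪ (openEdge f₁ ∩ openEdge f₂ ∩ W))ᶜ ∩ ((openEdge f₁ ∩ A) ∪ (openEdge f₂ ∩ W))ᶜ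
        ∩ (openEdge f₁ ∪ (openEdge f₂ ∩ Γ)))} = Aᶜ ∩ Wᶜ := by
    ext ω; simp [hs1, hA, hW, hΓ]
  have e10 : {ω | Function.update (Function.update ω f₁ true) f₂ false ∈
      ((A ∪ (openEdge f₁ ∩ openEdge f₂ ∩ W))ᶜ ∩ ((openEdge f₁ ∩ A) ∪ (openEdge f₂ ∩ W))ᶜ
        ∩ (openEdge f₁ ∪ (openEdge f₂ ∩ Γ)))} = Aᶜ := by
    ext ω; simp [hs1, hA, hW, hΓ]
  have e01 : {ω | Function.update (Function.update ω f₁ false) f₂ true ∈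
      ((A ∪ (openEdge f₁ ∩ openEdge f₂ ∩ W))ᶜ ∩ ((openEdge f₁ ∩ A) ∪ (openEdge f₂ ∩ W))ᶜ
        ∩ (openEdge f₁ ∪ (openEdge f₂ ∩ Γ)))} = Aᶜ ∩ Wᶜ ∩ Γ := by
    ext ω; simp [hs1, hA, hW, hΓ]
  have e00 : {ω | Function.update (Function.update ω f₁ false) f₂ false ∈
      ((A ∪ (openEdge f₁ ∩ openEdge f₂ ∩ W))ᶜ ∩ ((openEdge f₁ ∩ A) ∪ (openEdge f₂ ∩ W))ᶜ
        ∩ (openEdge f₁ ∪ (openEdge f₂ ∩ Γ)))} = ∅ := by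
    ext ω; simp [hs1]
  rw [e11, e10, e01, e00, prob_empty]; ring

include hf hA hW hΓ in
/-- The cell expansion of `P(D) = P(eᶜ ∩ Lᶜ ∩ γᶜ)`. -/
lemma oa3w_prob_D :
    prob p ((A ∪ (openEdge f₁ ∩ openEdge f₂ ∩ W))ᶜ ∩ ((openEdge f₁ ∩ A) ∪ (openEdge f₂ ∩ W))ᶜ
        ∩ (openEdge f₁ ∪ (openEdge f₂ ∩ Γ))ᶜ)
      = (1 - p f₁) * p f₂ * prob p (Aᶜ ∩ Wᶜ ∩ Γᶜ) + (1 - p f₁) * (1 - p f₂) * prob p Aᶜ := by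
  have hs1 := update2_fst hf
  rw [prob_two_pin p hf]
  have e11 : {ω | Function.update (Function.update ω f₁ true) f₂ true ∈
      ((A ∪ (openEdge f₁ ∩ openEdge f₂ ∩ W))ᶜ ∩ ((openEdge f₁ ∩ A) ∪ (openEdge f₂ ∩ W))ᶜ
        ∩ (openEdge f₁ ∪ (openEdge f₂ ∩ Γ))ᶜ)} = ∅ := by
    ext ω; simp [hs1]
  have e10 : {ω | Function.update (Function.update ω f₁ true) f₂ false ∈
      ((A ∪ (openEdge f₁ ∩ openEdge f₂ ∩ W))ᶜ ∩ ((openEdge f₁ ∩ A) ∪ (openEdge f₂ ∩ W))ᶜ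
        ∩ (openEdge f₁ ∪ (openEdge f₂ ∩ Γ))ᶜ)} = ∅ := by
    ext ω; simp [hs1]
  have e01 : {ω | Function.update (Function.update ω f₁ false) f₂ true ∈
      ((A ∪ (openEdge f₁ ∩ openEdge f₂ ∩ W))ᶜ ∩ ((openEdge f₁ ∩ A) ∪ (openEdge f₂ ∩ W))ᶜ
        ∩ (openEdge f₁ ∪ (openEdge f₂ ∩ Γ))ᶜ)} = Aᶜ ∩ Wᶜ ∩ Γᶜ := by
    ext ω; simp [hs1, hA, hW, hΓ]
  have e00 : {ω | Function.update (Function.update ω f₁ false) f₂ false ∈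
      ((A ∪ (openEdge f₁ ∩ openEdge f₂ ∩ W))ᶜ ∩ ((openEdge f₁ ∩ A) ∪ (openEdge f₂ ∩ W))ᶜ
        ∩ (openEdge f₁ ∪ (openEdge f₂ ∩ Γ))ᶜ)} = Aᶜ := by
    ext ω; simp [hs1, hA, hW, hΓ]
  rw [e11, e10, e01, e00, prob_empty]; ring

end CellsI

end Summit.Ventures.PercRepro2
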